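import Mathlib.Data.Fin.Tuple.Sort
import Literature.Combinatorics.Sahi2008.ProvedCases
import Summits.CriticalPhenomena.PercolationContinuityZ3.Theorems.PercNearOneGluingNoHeavyLowerTailSahiGridThree
import Summits.CriticalPhenomena.PercolationContinuityZ3.Theorems.PercNearOneGluingNoHeavyLowerTailSahiGridConjectureIff
import Summits.CriticalPhenomena.PercolationContinuityZ3.Theorems.PercNearOneGluingNoHeavyLowerTailSahiWidthKahn

/-!
# `NoHeavyLowerTail` (crux stmt-CriticalPhenomena-4575), Sahi programme P1: **THE PATTERN FUNCTIONAL IN EVERY DIMENSION** —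
# Sahi's `C₃` (⟺ Kahn's Conjecture 5) follows from ONE finite inequality per dimension on the small cube `[3]^d`

Support file (Sahi cell, seat `prim-sahi-p1`, generation 7; `--supports stmt-CriticalPhenomena-4575`).  Pure proofs; the only
definitions are the bookkeeping ones of the localisation (`Tmap`, `Ssym`, `col`, `sStarD`, `pb`) and the finite predicate
`PatternPos d`; no `sorry`; kernel-checked, standard axioms.  (The settled dimensions `d ≤ 3` are re-exported from the
COMPUTATIONAL certificate of `…SahiGridThreeCheck{,B,Two}` in the companion file `…SahiGridPatternThree`.)

THE MATHEMATICS.  For `d ≥ 0` let `P_d = [3]^d = Fin d → Fin 3` (pointwise order) and, for `A, B, C ⊆ P_d`,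
  `sStarD A B C := Σ_{π ∈ S₃^d} h(P^π_0, P^π_1, P^π_2)`,   `P^π_c = (a ↦ π_a c)`,
  `h(x,y,z) = 2·A(x)B(x)C(x) − A(x)B(y)C(y) − B(x)A(y)C(y) − C(x)A(y)B(y) + A(x)B(y)C(z)`
(the three-copy kernel of Sahi's `E₃` summed over the `6^d` "permutation patterns": triples of points of `[3]^d` using all three
values in every axis).  PROBABILISTIC READING: `sStarD A B C / 6^d = 𝔼 h(ω¹,ω²,ω³)` where `(ω¹,ω²,ω³)` is a LATIN HYPERCUBE SAMPLE
of three points of `[3]^d` (independently in each axis, the three copies receive the three values in uniformly random order); with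
three INDEPENDENT uniform points instead, `𝔼 h` would be Sahi's `E₃(1_A,1_B,1_C)` for the uniform weight.  Define
  `PatternPos d :⟺ sStarD A B C ≥ 0 for all up-sets A, B, C of [3]^d`.
* `latticeE3_symm`, `S_eq_sStarD`, `Ssym_nonneg_of`: for every product weight `⊗_a g_a ≥ 0` on a grid `[K+1]^d` and all up-sets,
  `(6^d)·latticeE3 w A B C = Σ_ω (∏ w(ω_c)) · sStarD(A*_ω, B*_ω, C*_ω)` with pulled-back (and, after sorting the copies axis by
  axis, UP-) sets of the small cube — i.e. `PatternPos d` says exactly that the homogeneous Sahi cubic `Z³E₃` is a polynomial in the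
  `d` chain-weight vectors with NONNEGATIVE COEFFICIENTS (the coefficient of a monomial with three distinct values per axis is a
  positive multiple of `sStarD` of a pulled-back up-set triple; repeated values are pull-backs along non-injective maps).
* `latticeE3_gridProd_nonneg_of`, `liebSahi_grid_of_patternPos`: `PatternPos d ⟹` layer `P(d,3)` of the width stratification
  (every product probability weight on every `d`-dimensional grid is Sahi-positive of order 3), hence (`SahiWidth.*`) `U(d,3)`,
  `W(d,3)` (all FKG weights on `d`-grids and on lattices of J-width `≤ d`) and `LiebSahiContinuum d 3`.
* **`sahiConjecture_three_of_forall_patternPos`, `kahnConjecture_of_forall_patternPos`**: `(∀ d, PatternPos d) ⟹ SahiConjecture 3`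
  (Sahi 2008 Conj. 5 at `n = 3` for every FKG weight on every finite distributive lattice) `⟺ KahnConjecture` (Kahn 2022 Conj. 5).
  So Kahn's conjecture is reduced to a sequence of FINITE third-order inequalities for Latin hypercube samples, one per dimension.
* `patternPos_anti` (pull-back along the last axis: `PatternPos (d+1) → PatternPos d`), `patternPos_of_le`; the companion file
  `…SahiGridPatternThree` gives `patternPos_three` [COMPUTATIONAL] and `patternPos_of_le_three`.  STATUS: `PatternPos d` holds for `d ≤ 3` (d = 3: 157 345 860 up-set triples,
  certified); for `d = 2` the tensor of `sStarD` is moreover a nonnegative combination of products `γ₁(A)γ₂(B)γ₃(C)` of point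
  evaluations and cover differences `1_A(q) − 1_A(p)`, `p ⋖ q` (58 orbit terms, seat folder `code/cert_sym_d2.json`), whereas for
  `d = 3` NO such decomposable certificate exists — an exact Farkas witness `s : ([3]³)³ → ℚ ∩ [0,1]`, invariant under axis and
  slot permutations, with `⟨γ₁⊗γ₂⊗γ₃, s⟩ ≥ 0` for all `81³` generator triples and `⟨t₃, s⟩ = −4`, is attached to item 4575 (kit
  j098378, verifier `code/verify_witness.py`): the `[3]³` inequality is NOT a sum of products of monotone differences.  `d = 4, 5`: random search found no negative value (kit j094890/j095940, gen 6); OPEN.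
Nothing in this file asserts `PatternPos d` for `d ≥ 4`, `SahiConjecture 3` or `KahnConjecture`. [this work]
-/

namespace Summit.CriticalPhenomena.PercolationContinuityZ3.Theorems.SahiGridPattern

open Finset Literature.Probability.LatticeModels Literature.Combinatorics.Sahi2008
open SahiGrid3 (ind hZ latticeE3_eq_sum_copies)
open scoped BigOperators

noncomputable section

variable {d K : ℕ}

/-- The grid `[K+1]^d`. [this work] -/
abbrev Xd (d K : ℕ) := Fin d → Fin (K + 1)

/-- The small cube `[3]^d`. [this work] -/
abbrev Pd (d : ℕ) := Fin d → Fin 3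

/-! ### Re-indexing the three copies axis by axis -/

/-- `(T_π ω)_c(a) = ω_{π_a c}(a)`: permute the three copies separately in each axis. [this work] -/
def Tmap (π : Fin d → Equiv.Perm (Fin 3)) (ω : Fin 3 → Xd d K) : Fin 3 → Xd d K := fun c a => ω (π a c) a

/-- `T_π` as an equivalence. [this work] -/
def Tequiv (π : Fin d → Equiv.Perm (Fin 3)) : (Fin 3 → Xd d K) ≃ (Fin 3 → Xd d K) where
  toFun := Tmap π
  invFun := fun ω c a => ω ((π a).symm c) a
  left_inv := fun ω => by funext c a; simp [Tmap]
  right_inv := fun ω => by funext c a; simp [Tmap]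

/-- The product weight of the three copies is invariant under re-indexing. [this work] -/
theorem weight_Tmap (g : Fin d → Fin (K + 1) → ℝ) (π : Fin d → Equiv.Perm (Fin 3)) (ω : Fin 3 → Xd d K) :
    (∏ c, ∏ a, g a (Tmap π ω c a)) = ∏ c, ∏ a, g a (ω c a) := by
  calc (∏ c, ∏ a, g a (Tmap π ω c a)) = ∏ a, ∏ c, g a (ω (π a c) a) := Finset.prod_comm
    _ = ∏ a, ∏ c, g a (ω c a) := Finset.prod_congr rfl fun a _ => Equiv.prod_comp (π a) (fun c => g a (ω c a))
    _ = ∏ c, ∏ a, g a (ω c a) := Finset.prod_comm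

/-- The symmetrised three-copy kernel `S(ω) = Σ_{π ∈ S₃^d} h(T_π ω)`. [this work] -/
def Ssym (A B C : Finset (Xd d K)) (ω : Fin 3 → Xd d K) : ℤ :=
  ∑ π : Fin d → Equiv.Perm (Fin 3), hZ A B C (Tmap π ω 0) (Tmap π ω 1) (Tmap π ω 2)

/-- **Symmetrisation**: `|S₃^d| · latticeE3 = Σ_ω (∏ w) · S(ω)`. [this work] -/
theorem latticeE3_symm (g : Fin d → Fin (K + 1) → ℝ) (A B C : Finset (Xd d K)) :
    (Fintype.card (Fin d → Equiv.Perm (Fin 3)) : ℝ) * latticeE3 (fun ω : Xd d K => ∏ a, g a (ω a)) A B C =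
      ∑ ω : Fin 3 → Xd d K, (∏ c, ∏ a, g a (ω c a)) * (Ssym A B C ω : ℝ) := by
  have hπ : ∀ π : Fin d → Equiv.Perm (Fin 3), latticeE3 (fun ω : Xd d K => ∏ a, g a (ω a)) A B C =
      ∑ ω : Fin 3 → Xd d K, (∏ c, ∏ a, g a (ω c a)) * (hZ A B C (Tmap π ω 0) (Tmap π ω 1) (Tmap π ω 2) : ℝ) := by
    intro π
    rw [latticeE3_eq_sum_copies, ← Equiv.sum_comp (Tequiv π)]
    refine Finset.sum_congr rfl fun ω _ => ?_
    show (∏ c, ∏ a, g a (Tmap π ω c a)) * _ = _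
    rw [weight_Tmap]
    rfl
  rw [← nsmul_eq_mul, ← Finset.card_univ, ← Finset.sum_const, Finset.sum_congr rfl fun π _ => hπ π, Finset.sum_comm]
  refine Finset.sum_congr rfl fun ω _ => ?_
  rw [← Finset.mul_sum]
  unfold Ssym
  push_cast
  rfl

/-! ### The pattern functional `sStarD` on the small cube and the pull-back -/

/-- The `c`-th point of the permutation pattern `π ∈ S₃^d`: `a ↦ π_a c`. [this work] -/
def col (π : Fin d → Equiv.Perm (Fin 3)) (c : Fin 3) : Pd d := fun a => π a c

/-- **`sStarD`**: the three-copy kernel summed over the `6^d` permutation patterns of `[3]^d`. [this work] -/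
def sStarD (A B C : Finset (Pd d)) : ℤ :=
  ∑ π : Fin d → Equiv.Perm (Fin 3), hZ A B C (col π 0) (col π 1) (col π 2)

/-- **`PatternPos d`** — THE PATTERN INEQUALITY ON `[3]^d`: `sStarD A B C ≥ 0` for all up-sets `A, B, C` (equivalently: the
three-copy Sahi functional `E₃` of up-set indicators is nonnegative under three-point LATIN HYPERCUBE SAMPLING of `[3]^d`;
equivalently: the homogeneous Sahi cubic `Z³E₃` on `d`-dimensional grids with product weights has nonnegative coefficients in the
chain weights).  PROVED for `d ≤ 3` (`patternPos_of_le_three`, computational certificate for `d = 3`); OPEN for `d ≥ 4`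
(conjectured; random search clean for `d = 4, 5`); `patternPos_three` is in `…SahiGridPatternThree`.  `∀ d, PatternPos d`
implies Kahn's Conjecture 5 (`kahnConjecture_of_forall_patternPos`).  An obligation / hypothesis, never a fact. [this work]
[status: open for d ≥ 4; proved for d ≤ 3] -/
@[conjecture] def PatternPos (d : ℕ) : Prop :=
  ∀ A B C : Finset (Pd d), IsUpperSet (A : Set (Pd d)) → IsUpperSet (B : Set (Pd d)) → IsUpperSet (C : Set (Pd d)) →
    0 ≤ sStarD A B C

/-- Pull-back of a finset of the grid to the small cube along `ω`: `q ↦ (a ↦ ω_{q a}(a))`. [this work] -/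
def pb (ω : Fin 3 → Xd d K) (A : Finset (Xd d K)) : Finset (Pd d) := univ.filter fun q => (fun a => ω (q a) a) ∈ A

/-- Indicators under pull-back. [this work] -/
theorem ind_Tmap (A : Finset (Xd d K)) (ω : Fin 3 → Xd d K) (π : Fin d → Equiv.Perm (Fin 3)) (c : Fin 3) :
    ind A (Tmap π ω c) = ind (pb ω A) (col π c) := by
  unfold ind pb Tmap col
  simp only [mem_filter, mem_univ, true_and]

/-- **`S(ω) = sStarD (pb ω A) (pb ω B) (pb ω C)`.** [this work] -/
theorem S_eq_sStarD (A B C : Finset (Xd d K)) (ω : Fin 3 → Xd d K) :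
    Ssym A B C ω = sStarD (pb ω A) (pb ω B) (pb ω C) := by
  unfold Ssym sStarD
  refine Finset.sum_congr rfl fun π _ => ?_
  unfold hZ
  simp only [ind_Tmap]

/-- Composing with fixed permutations axis by axis does not change `S`. [this work] -/
theorem S_Tmap (A B C : Finset (Xd d K)) (σ : Fin d → Equiv.Perm (Fin 3)) (ω : Fin 3 → Xd d K) :
    Ssym A B C (Tmap σ ω) = Ssym A B C ω := by
  unfold Ssym
  have h : ∀ π : Fin d → Equiv.Perm (Fin 3), Tmap π (Tmap σ ω) = Tmap (fun a => (π a).trans (σ a)) ω := by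
    intro π; funext c a; rfl
  simp_rw [h]
  exact Fintype.sum_equiv (Equiv.piCongrRight fun a => Equiv.mulLeft (σ a)) _ _ fun π => rfl

/-- A sorted `ω` pulls up-sets back to up-sets. [this work] -/
theorem isUpperSet_pb {ω : Fin 3 → Xd d K} (hω : ∀ a, Monotone fun c => ω c a) {A : Finset (Xd d K)}
    (hA : IsUpperSet (A : Set (Xd d K))) : IsUpperSet (pb ω A : Set (Pd d)) := by
  intro q q' hqq' hq
  rw [Finset.mem_coe] at hq ⊢
  unfold pb at hq ⊢
  rw [mem_filter] at hq ⊢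
  exact ⟨mem_univ _, hA (fun a => hω a (hqq' a)) hq.2⟩

/-- **`S(ω) ≥ 0`** for up-sets, GIVEN the pattern inequality in dimension `d`: sort, pull back, apply it. [this work] -/
theorem Ssym_nonneg_of (hP : PatternPos d) {A B C : Finset (Xd d K)} (hA : IsUpperSet (A : Set (Xd d K)))
    (hB : IsUpperSet (B : Set (Xd d K))) (hC : IsUpperSet (C : Set (Xd d K))) (ω : Fin 3 → Xd d K) :
    0 ≤ Ssym A B C ω := by
  let σ : Fin d → Equiv.Perm (Fin 3) := fun a => Tuple.sort fun c => ω c a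
  have hsort : ∀ a, Monotone fun c => Tmap σ ω c a := fun a => by
    show Monotone ((fun c => ω c a) ∘ σ a)
    exact Tuple.monotone_sort _
  rw [← S_Tmap A B C σ ω, S_eq_sStarD]
  exact hP _ _ _ (isUpperSet_pb hsort hA) (isUpperSet_pb hsort hB) (isUpperSet_pb hsort hC)

/-! ### `PatternPos d ⟹ P(d,3)` -/

/-- **`PatternPos d ⟹` Sahi's `C₃` on every `d`-dimensional grid, homogeneous form**: `0 ≤ latticeE3 w A B C` for every
nonnegative product weight and all up-sets. [this work] -/
theorem latticeE3_gridProd_nonneg_of (hP : PatternPos d) (g : Fin d → Fin (K + 1) → ℝ) (hg : ∀ a u, 0 ≤ g a u)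
    {A B C : Finset (Xd d K)} (hA : IsUpperSet (A : Set (Xd d K))) (hB : IsUpperSet (B : Set (Xd d K)))
    (hC : IsUpperSet (C : Set (Xd d K))) : 0 ≤ latticeE3 (fun ω : Xd d K => ∏ a, g a (ω a)) A B C := by
  have hcard : (0 : ℝ) < Fintype.card (Fin d → Equiv.Perm (Fin 3)) := by exact_mod_cast Fintype.card_pos
  have h := latticeE3_symm g A B C
  have hsum : 0 ≤ ∑ ω : Fin 3 → Xd d K, (∏ c, ∏ a, g a (ω c a)) * (Ssym A B C ω : ℝ) :=
    Finset.sum_nonneg fun ω _ => mul_nonneg (Finset.prod_nonneg fun c _ => Finset.prod_nonneg fun a _ => hg a _)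
      (by exact_mod_cast Ssym_nonneg_of hP hA hB hC ω)
  rw [← h] at hsum
  exact (mul_nonneg_iff_of_pos_left hcard).1 hsum

/-- **`PatternPos d ⟹` layer `P(d,3)`**: every product probability weight on every grid `[K+1]^d` is Sahi-positive of order 3.
[this work] -/
theorem liebSahi_grid_of_patternPos (hP : PatternPos d) :
    ∀ (K : ℕ) (g : Fin d → Fin (K + 1) → ℝ), (∀ i u, 0 ≤ g i u) → (∀ i, ∑ u, g i u = 1) →
      SahiPositive (fun ω : Fin d → Fin (K + 1) => ∏ i, g i (ω i)) 3 := by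
  classical
  intro K g hg0 hg1
  rw [sahiPositive_iff_indicators]
  intro Uf hU
  have hsum : ∑ ω : Fin d → Fin (K + 1), ∏ i, g i (ω i) = 1 := by
    rw [← Fintype.prod_sum]; simp [hg1]
  have hf : (fun i => setInd (Uf i)) = ![setInd (Uf 0), setInd (Uf 1), setInd (Uf 2)] := by
    funext i; fin_cases i <;> rfl
  rw [hf, sahiE_three_indicator_eq_latticeE3 hsum]
  exact latticeE3_gridProd_nonneg_of hP g hg0 (hU 0) (hU 1) (hU 2)

/-- `PatternPos d ⟹ U(d,3)`: the uniform weight on every box `[M]^d` is Sahi-positive of order 3. [this work] -/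
theorem uniformGrid_of_patternPos (hP : PatternPos d) :
    ∀ M, 0 < M → SahiPositive (fun _ : Fin d → Fin M => (1 : ℝ) / (M : ℝ) ^ d) 3 :=
  (SahiWidth.liebSahi_grid_iff_uniform d 3).1 (liebSahi_grid_of_patternPos hP)

/-- `PatternPos d ⟹ W(d,3)`: EVERY FKG probability weight on every grid `[b+1]^d` is Sahi-positive of order 3. [this work] -/
theorem fkg_grid_of_patternPos (hP : PatternPos d) :
    ∀ (b : ℕ) (μ : (Fin d → Fin (b + 1)) → ℝ), IsFKGMeasure μ → SahiPositive μ 3 :=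
  (SahiWidth.liebSahi_grid_iff_fkg_grid d 3).1 (liebSahi_grid_of_patternPos hP)

/-- `PatternPos d ⟹` Sahi's `C₃` for every FKG weight on every finite distributive lattice with a lattice embedding into a
`d`-dimensional grid (J-width `≤ d`). [this work] -/
theorem sahiPositive_three_of_latticeEmbedding_of_patternPos (hP : PatternPos d) {L : Type*} [DistribLattice L] [Fintype L]
    [DecidableEq L] {b : ℕ} (e : L → (Fin d → Fin (b + 1))) (he : Function.Injective e) (hinf : ∀ x y, e (x ⊓ y) = e x ⊓ e y)
    (hsup : ∀ x y, e (x ⊔ y) = e x ⊔ e y) {μ : L → ℝ} (hμ : IsFKGMeasure μ) : SahiPositive μ 3 :=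
  SahiWidth.sahiPositive_of_latticeEmbedding_grid (liebSahi_grid_of_patternPos hP) e he hinf hsup hμ

/-- `PatternPos d ⟹` Lieb–Sahi's Conjecture 1.1 on `[0,1]^d` at order 3 (Lebesgue measure, monotone functions). [this work] -/
theorem liebSahiContinuum_of_patternPos (hP : PatternPos d) : LiebSahiContinuum d 3 :=
  (liebSahiContinuum_iff_uniformGrid d 3).2 (uniformGrid_of_patternPos hP)

/-! ### The reduction of Sahi's `C₃` / Kahn's Conjecture 5 to the pattern inequalities -/

/-- **The pattern inequalities in all dimensions imply Sahi's `C₃`**: if `sStarD ≥ 0` on up-set triples of `[3]^d` for every `d`,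
then every FKG probability weight on every finite distributive lattice satisfies `E₃(f,g,h) ≥ 0` for nonnegative monotone `f,g,h`
(Sahi 2008, Conj. 5 at `n = 3`; Lieb–Sahi 2022, Conj. 1.1 at `n = 3`). [this work] -/
theorem sahiConjecture_three_of_forall_patternPos (hP : ∀ d, PatternPos d) : SahiConjecture 3 :=
  (SahiWidth.sahiConjecture_iff_forall_grid 3).2 fun d K g hg0 hg1 => liebSahi_grid_of_patternPos (hP d) K g hg0 hg1

/-- **The pattern inequalities in all dimensions imply Kahn's Conjecture 5** (`E₃ ≥ 0` for three increasing events under every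
product measure on a finite cube). [this work] -/
theorem kahnConjecture_of_forall_patternPos (hP : ∀ d, PatternPos d) : KahnConjecture :=
  sahiConjecture_three_iff_kahnConjecture.1 (sahiConjecture_three_of_forall_patternPos hP)

/-! ### Monotonicity in the dimension, and the settled dimensions `d ≤ 3` -/

/-- Lifting a subset of `[3]^d` to `[3]^{d+1}` by ignoring the last coordinate. [this work] -/
def liftSet (A : Finset (Pd d)) : Finset (Pd (d + 1)) := univ.filter fun q => Fin.init q ∈ A

/-- The lift of an up-set is an up-set. [this work] -/
theorem isUpperSet_liftSet {A : Finset (Pd d)} (hA : IsUpperSet (A : Set (Pd d))) :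
    IsUpperSet (liftSet A : Set (Pd (d + 1))) := by
  intro q q' hqq' hq
  rw [Finset.mem_coe] at hq ⊢
  unfold liftSet at hq ⊢
  rw [mem_filter] at hq ⊢
  exact ⟨mem_univ _, hA (fun a => hqq' (Fin.castSucc a)) hq.2⟩

/-- Indicator of a lift. [this work] -/
theorem ind_liftSet (A : Finset (Pd d)) (q : Pd (d + 1)) : ind (liftSet A) q = ind A (Fin.init q) := by
  unfold ind liftSet
  simp only [mem_filter, mem_univ, true_and]

/-- **`sStarD` of lifted sets**: `sStarD (lift A) (lift B) (lift C) = 6 · sStarD A B C`. [this work] -/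
theorem sStarD_liftSet (A B C : Finset (Pd d)) :
    sStarD (liftSet A) (liftSet B) (liftSet C) = 6 * sStarD A B C := by
  unfold sStarD
  rw [← (Fin.snocEquiv fun _ : Fin (d + 1) => Equiv.Perm (Fin 3)).sum_comp, Fintype.sum_prod_type]
  have h : ∀ (e : Equiv.Perm (Fin 3)) (π : Fin d → Equiv.Perm (Fin 3)) (c : Fin 3),
      Fin.init (col ((Fin.snocEquiv fun _ : Fin (d + 1) => Equiv.Perm (Fin 3)) (e, π)) c) = col π c := by
    intro e π c
    funext a
    show (Fin.snocEquiv (fun _ : Fin (d + 1) => Equiv.Perm (Fin 3)) (e, π)) (Fin.castSucc a) c = π a c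
    simp [Fin.snocEquiv]
  have h6 : Fintype.card (Equiv.Perm (Fin 3)) = 6 := by
    rw [Fintype.card_perm, Fintype.card_fin]; rfl
  simp only [hZ, ind_liftSet, h]
  rw [Finset.sum_const, Finset.card_univ, h6, nsmul_eq_mul, Nat.cast_ofNat]

/-- **`PatternPos` is antitone in the dimension**: `PatternPos (d+1) → PatternPos d`. [this work] -/
theorem patternPos_anti (h : PatternPos (d + 1)) : PatternPos d := by
  intro A B C hA hB hC
  have h6 := h _ _ _ (isUpperSet_liftSet hA) (isUpperSet_liftSet hB) (isUpperSet_liftSet hC)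
  rw [sStarD_liftSet] at h6
  omega

/-- `PatternPos` descends along `≤`. [this work] -/
theorem patternPos_of_le {d d' : ℕ} (hdd' : d ≤ d') (h : PatternPos d') : PatternPos d := by
  induction d' with
  | zero => rwa [Nat.le_zero.1 hdd']
  | succ n ih => 
    rcases Nat.lt_or_eq_of_le hdd' with hlt | rfl
    · exact ih (Nat.lt_succ_iff.1 hlt) (patternPos_anti h)
    · exact h

end

end Summit.CriticalPhenomena.PercolationContinuityZ3.Theorems.SahiGridPattern
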